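import Summits.BirchSwinnertonDyer.Rank1Residual.ManinAdditive.ConwayKodairaLaws
import Literature.NumberTheory.EllipticCurves.SemistabilityDefect
import Literature.NumberTheory.DiophantineGeometry.TateAlgorithm
import Literature.NumberTheory.DiophantineGeometry.KodairaSymbol
import HarnessLib
import HarnessLib.Audit.Tags

/-!
# THE TORSION-FREE I₀* CLASS AT `2` IS DECIDED BY THE LOCAL INERTIA TYPE — desc g7 rows E-desc-48/49/50 + support
# (MEMO-desc §24; typing ask T-desc-11) — cell `bsd-f2-manin` (D-0131 (3) frontier: the Manin constant at additive primes)

HONEST FRAMING.  LENS = descent / visibility (seat `bsd-f2-manin-desc`, g7; HOME `run/shared/lean/pub/bsd-f2-manin/MEMO-desc.md`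
§24, HOME/desc/g7/MEMO-24.md).  Source: HOME/desc/g7/Sketch-desc-g7.lean sha16 **416c7176b46a69c3** (246 l.; farm rc 0 · 0 errors
· 0 warnings · 0 sorries), namespace `…ManinAdditive.DescG7` ↦ `…ManinAdditive.ConwayCut` (the namespace of the landed Conway-cut
vocabulary it extends, like `ConwayKodairaLaws.lean` p626258); declarations VERBATIM (bodies byte-identical) except that desc's copy
of `placeTwo` is NOT re-declared (`ConwayCut.placeTwo`, p626258, same term).  Rows typed `@[conjecture]` (nothing asserted):
E-desc-48 `PrimitiveIZeroStarDefectLawAtTwo`, E-desc-49 `ImprimitiveTightIZeroStarFullLawAtTwo`, E-desc-50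
`TorsionFreeIZeroStarDichotomyAtTwo`, the support restriction `ClassAGlobalDefectLawAtTwo` (= g6 E-desc-44′ ∨ E-desc-46 on
class A) and the support row `ConwayDefectTransfer` (defect twin of `ConwayDepthTransfer`; THEOREM-candidate — its lattice
content is PROVED in the tree by bsd-line-manin23-p3, P-desc-1 `…Theorems.ManinLocalTwoThree.conwayDefectTransfer_of_mem`,
2026-08-28T11:11Z); PROVED glue VERBATIM: `dichotomy_of_laws`, `two_dvd_manin_or_not_lieSaturated_of_conwayDefect`,
`not_lieSaturatedAt_two_of_primitive`.

THE FINDING (desc g7).  CLASS A at `2` := Kodaira `I₀*` at `2` ∧ `E(ℚ)[2] = 0` (`IsTorsionFreeIZeroStarAtTwo`; inside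
refuter-1's repaired residual class §R57 F2); `e₂ := semistabilityDefectAt 2 ∈ {6, 8, 24}` there.  LAW (E-desc-50):
`σ₂ = ord₂ deg φ − ord₂[e_f S^G : ℤf] = 0 ⟺ (rank 0 ∧ v₂∏c_q ≤ v₂#tors ∧ e₂ ≠ 24)`; one-sided halves E-desc-48
(primitive `e₂ = 24`, `SL₂(𝔽₃)` type ⇒ defect) and E-desc-49 (dihedral `e₂ ∈ {6,8}` ∧ 2-tight ⇒ FULL depth — the first
full-depth law on the residual class with irreducible `E[2]`; with GIVEN E-28♯ + `ConwayDepthTransfer` it discharges `2 ∤ c_E`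
and Lie-saturation at `2` table-free).  WHY NOVEL (desc): on the tight class-A rows `Sel₂(E) = 0`, so no
Watkins/Dummigan/AL statement separates `e₂ = 24` from `{6,8}`; corpus + galaxy presearch found no `deg φ` / congruence
statement keyed to the primitive-vs-dihedral inertia type.

BC5 WITNESS (desc census HOME/desc/g7/census48-2000.txt d808cfa24bd797cc; ENGINE MS-0 g6 rev 5, E-blind modular symbols;
rows HOME/desc/g7/out/ms0-*.txt): 39/39 class-A rows with `σ₂` known — tight ∧ `e₂ = 24`: `σ₂ = 1` 9/9; tight ∧ `e₂ ∈ {6,8}`: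
`σ₂ = 0` 8/8; loose: `σ₂ = 1` 22/22 — 17 of the 39 PRE-REGISTERED out-of-sample in g7 (levels 656…912; 88/89 predictions
hit, the one miss = hypothesis H2 killed by 656b1); 65 class-A optimal curves `N ≤ 2000` untested (23 tight) = the falsifier
pool (D-desc-8 (vi)–(ix)).  REFUTER VERDICTS: refuter-1 R-desc-12 ANSWERED §R64 (2026-08-28T12:55Z, HOME/ref1/R64-ref1-desc-g7g8.md 47945fc54b95c773):
E-desc-48 / 49 / 50 LAWS SURVIVE, `ClassAGlobalDefectLawAtTwo` SURVIVES, `ConwayDefectTransfer` VALID on paper (THEOREM-candidate),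
the two consequences PROVED correct (kernel C72a rc 0 · 0/0/0), BC7 CLEAN summit mode, ENGINE U reproduces the census
(class A ≤ 2000 = 104 = 39 + 65, 23 tight); hygiene H-3: rows 48 / 49 / 50 do not carry `D.f ∈ conwayStableLattice N` /
`lineIndex ≠ 0` (automatic on paper at `4 ∣ N`; `ConwayDefectTransfer` and p625467 carry them) — a prover composing
E-desc-48 with the transfer must supply them; refuter-2 placement pending.  bears_on:
stmt-BirchSwinnertonDyer-22967 (C2 `ManinOddAtFour`, residual class at `2`).  PARTITION ladder-live · beyond-print theorem:
no · BSD is not proved by this; Manin's conjecture is not proved by this.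
-/

set_option autoImplicit false

noncomputable section

open scoped MatrixGroups ModularForm

open CongruenceSubgroup WeierstrassCurve Literature.NumberTheory.EllipticCurves.ModularForms
  Literature.NumberTheory.DiophantineGeometry

namespace Summit.BirchSwinnertonDyer.Rank1Residual.ManinAdditive.ConwayCut

/-! ## T-desc-11 (desc g7, MEMO-desc §24): the torsion-free `I₀*` class at `2` (`placeTwo` = the landed `ConwayCut.placeTwo`) -/

/-! ### Vocabulary (elementary; E-facing) -/

/-- CLASS A at `2`: Kodaira symbol `I₀*` at `2` (Tate's algorithm, tree decl `WeierstrassCurve.kodairaSymbolAt`) and NO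
rational 2-torsion (`E[2](ℚ) = 0`, tree decl `ConwayCut.HasRationalTwoTorsion`).  For such curves `#E(ℚ)_tors` is odd,
`E[2]` is an irreducible Galois module, and the reduction at `2` is potentially good (supersingular) with
`e₂ ∈ {6, 8, 24}` in the census. -/
def IsTorsionFreeIZeroStarAtTwo (W : WeierstrassCurve ℚ) : Prop :=
  W.kodairaSymbolAt placeTwo = .Istar 0 ∧ ¬ HasRationalTwoTorsion W

/-- «2-TIGHT»: no global 2-adic excess — Mordell–Weil rank `0` and `v₂(∏_q c_q) ≤ v₂(#E(ℚ)_tors)` (tree decls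
`WeierstrassCurve.mordellWeilRank`, `tamagawaProduct`, `torsionOrder`).  The complement («loose») is exactly the
hypothesis of g6's one-sided laws E-desc-44′ (rank) and E-desc-46 (Tamagawa excess). -/
def IsTwoTight (W : WeierstrassCurve ℚ) : Prop :=
  W.mordellWeilRank = 0 ∧ padicValNat 2 W.tamagawaProduct ≤ padicValNat 2 W.torsionOrder

/-! ### Candidate laws (nothing asserted; census = HOME/desc/g7/census48-2000.txt) -/

section Laws

open scoped Classical

/-- **E-desc-48 `PrimitiveIZeroStarDefectLawAtTwo`** (one-sided LAW, defect side; census 15/15: the nine tight rows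
176a1 304d1 432g1 432h1 560a1 560b1 592b1 816c1 816d1 and the six loose rows 592a1 688a1 912a1 912c1 944a1 944b1): an optimal curve of
class A at `2` whose semistability defect at `2` is `24` (primitive local type `SL₂(𝔽₃)`) has Conway defect one,
`ord₂ [e_f S^G : ℤ f] + 1 = ord₂ deg φ`.  With `c_E` odd this says (via `ConwayDefectTransfer` + `depthAt_iff`): the
optimal map `E → J₀(N)` is NOT Lie-saturated at `2`.
Why it might fail: a class-A curve with `e₂ = 24`, rank 0, odd `∏ c_q` and FULL depth beyond `N = 944` (12 tight
untested candidates with `N ≤ 2000`: 1200c1 1200d1 1200f1 1200h1 1472e1 1472g1 1472j1 1472k1 1584d1 1840b1 1984e1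
1984g1); or `σ₂ = 2` at a deep level.
[sources: this census; Kraus 1990 Manuscripta Math. 69 (e₂ ∈ {2,3,4,6,8,24}); Coppola 2020 arXiv:1812.05651 §2;
 Agashe–Ribet–Stein 2012 Thm 3.10 / §4.4 (Raynaud's tangent-space sequence at e = ℓ − 1, the semistable shadow)] -/
@[conjecture]
def PrimitiveIZeroStarDefectLawAtTwo : Prop :=
  ∀ (W : WeierstrassCurve ℚ) [W.IsElliptic] [W.IsGloballyMinimal] [NeZero (W.conductorNorm ℤ)]
    (D : ModularParametrizationData W (W.conductorNorm ℤ)),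
    (∀ z ∈ D.L.lattice, ∃ w ∈ periodLattice D.f, z = D.c * w) →
    (∀ (W' : WeierstrassCurve ℚ) [W'.IsElliptic]
        (D' : ModularParametrizationData W' (W.conductorNorm ℤ)),
        D'.f = D.f → D.modularDegree ≤ D'.modularDegree) →
    4 ∣ W.conductorNorm ℤ → IsTorsionFreeIZeroStarAtTwo W → W.semistabilityDefectAt 2 = 24 →
      padicValNat 2 (lineIndex (conwayStableLattice (W.conductorNorm ℤ)) D.f) + 1 =
        padicValNat 2 D.modularDegree

/-- **E-desc-49 `ImprimitiveTightIZeroStarFullLawAtTwo`** (one-sided LAW, full side; census 8/8: 464d1 464f1 (`e₂ = 6`),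
416a1 608c1 800e1 800f1 864d1 864g1 (`e₂ = 8`)): an optimal curve of class A at `2` with DIHEDRAL local type
(`e₂ ≠ 24`), rank `0` and no Tamagawa excess has FULL Conway depth, `ord₂ [e_f S^G : ℤ f] = ord₂ deg φ`; with the
GIVEN row E-desc-28♯ and `ConwayDepthTransfer` this discharges `2 ∤ c_E` AND Lie-saturation at `2` for these curves
with no input from Cremona's tables — the first full-depth law on the residual class with irreducible `E[2]`.
Why it might fail: the sample is 8 curves at 6 levels; a `Q₈`-curve at `2⁵ ∥ N` with an odd congruence prime
interacting with the 2-part of `deg φ`, or an `e₂ = 6` class-A curve at `2⁴·q` with `q ≡ 1 (mod 8)`, could show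
`σ₂ = 1` while tight (11 tight untested candidates `N ≤ 2000`: 1264c1 1296g1 1296i1 1472f1 1472l1 1984f1 1984h1
(e₂ = 6); 1696b1 1760c1 1760d1 1760m1 (e₂ = 8)); and a tight curve with `Ш(E)[2] ≠ 0` (none in class A below 6000)
is predicted DEFECT by the modular-symbol reading (MEMO §24.6) but FULL by this row as typed.
[sources: this census; Kraus 1990; Watkins 2002 Exp. Math. 11 §4 doi:10.1080/10586458.2002.10504701 (2^r ∣ deg φ
heuristics); Česnavičius–Neururer–Saha arXiv:1911.09446 Thm 1.2 (shape of the Manin consequence)] -/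
@[conjecture]
def ImprimitiveTightIZeroStarFullLawAtTwo : Prop :=
  ∀ (W : WeierstrassCurve ℚ) [W.IsElliptic] [W.IsGloballyMinimal] [NeZero (W.conductorNorm ℤ)]
    (D : ModularParametrizationData W (W.conductorNorm ℤ)),
    (∀ z ∈ D.L.lattice, ∃ w ∈ periodLattice D.f, z = D.c * w) →
    (∀ (W' : WeierstrassCurve ℚ) [W'.IsElliptic]
        (D' : ModularParametrizationData W' (W.conductorNorm ℤ)),
        D'.f = D.f → D.modularDegree ≤ D'.modularDegree) →
    4 ∣ W.conductorNorm ℤ → IsTorsionFreeIZeroStarAtTwo W → W.semistabilityDefectAt 2 ≠ 24 → IsTwoTight W →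
      padicValNat 2 (lineIndex (conwayStableLattice (W.conductorNorm ℤ)) D.f) =
        padicValNat 2 D.modularDegree

/-- **E-desc-50 `TorsionFreeIZeroStarDichotomyAtTwo`** (the EXACT law on class A; census 39/39 = 17 tight + 22 loose,
both sides exercised: 8 full, 31 defect): for an optimal curve of class A at `2`,
`ord₂ [e_f S^G : ℤ f] = ord₂ deg φ ⟺ (rank 0 ∧ v₂ ∏c_q ≤ v₂ #tors ∧ e₂ ≠ 24)`.
It is the conjunction of E-desc-48, E-desc-49 and g6's E-desc-44′/46 restricted to class A (`dichotomy_of_laws`,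
PROVED below); filed as one row so that a refuter can attack the `⟺` directly.
Why it might fail: either one-sided half fails (see E-desc-48/49); in addition the `⟹` direction needs `σ₂ ≤ 1`
nowhere but inherits every counterexample to E-desc-44′/46 inside class A.
[sources: this census; the sources of E-desc-48/49; MEMO-desc §23 (E-desc-44/46)] -/
@[conjecture]
def TorsionFreeIZeroStarDichotomyAtTwo : Prop :=
  ∀ (W : WeierstrassCurve ℚ) [W.IsElliptic] [W.IsGloballyMinimal] [NeZero (W.conductorNorm ℤ)]
    (D : ModularParametrizationData W (W.conductorNorm ℤ)),
    (∀ z ∈ D.L.lattice, ∃ w ∈ periodLattice D.f, z = D.c * w) →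
    (∀ (W' : WeierstrassCurve ℚ) [W'.IsElliptic]
        (D' : ModularParametrizationData W' (W.conductorNorm ℤ)),
        D'.f = D.f → D.modularDegree ≤ D'.modularDegree) →
    4 ∣ W.conductorNorm ℤ → IsTorsionFreeIZeroStarAtTwo W →
      (padicValNat 2 (lineIndex (conwayStableLattice (W.conductorNorm ℤ)) D.f) =
          padicValNat 2 D.modularDegree ↔
        (IsTwoTight W ∧ W.semistabilityDefectAt 2 ≠ 24))

/-- Support restriction (NOT a new row): g6's one-sided residual laws E-desc-44′ (`0 < rank ⇒` defect) and E-desc-46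
(Tamagawa excess `⇒` defect), restricted to class A (class A ⊆ the REPAIRED residual class of refuter-1 §R57 (F2):
`I₀*` at `2` and no rational 2-torsion at all, a fortiori none in `E⁰(ℚ₂)`).  Census on class A: 22/22 (176c1 304f1
416b1 432b1 560e1 560f1 592a1 592d1 608f1 688a1 688b1 800b1 800i1 816g1 816i1 864a1 864j1 912a1 912c1 912i1 944a1
944b1). [sources: MEMO-desc §23; HOME/desc/Sketch-desc-g6.lean rev 5 `DescG6.residual_defect_of_rank_or_tamagawa`] -/
@[conjecture]
def ClassAGlobalDefectLawAtTwo : Prop :=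
  ∀ (W : WeierstrassCurve ℚ) [W.IsElliptic] [W.IsGloballyMinimal] [NeZero (W.conductorNorm ℤ)]
    (D : ModularParametrizationData W (W.conductorNorm ℤ)),
    (∀ z ∈ D.L.lattice, ∃ w ∈ periodLattice D.f, z = D.c * w) →
    (∀ (W' : WeierstrassCurve ℚ) [W'.IsElliptic]
        (D' : ModularParametrizationData W' (W.conductorNorm ℤ)),
        D'.f = D.f → D.modularDegree ≤ D'.modularDegree) →
    4 ∣ W.conductorNorm ℤ → IsTorsionFreeIZeroStarAtTwo W →
    (0 < W.mordellWeilRank ∨ padicValNat 2 W.torsionOrder < padicValNat 2 W.tamagawaProduct) →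
      padicValNat 2 (lineIndex (conwayStableLattice (W.conductorNorm ℤ)) D.f) + 1 =
        padicValNat 2 D.modularDegree

/-- GLUE (PROVED): the dichotomy E-desc-50 is exactly E-desc-48 ∧ E-desc-49 ∧ (E-desc-44′ ∨ E-desc-46 on class A). -/
theorem dichotomy_of_laws (h48 : PrimitiveIZeroStarDefectLawAtTwo) (h49 : ImprimitiveTightIZeroStarFullLawAtTwo)
    (hglob : ClassAGlobalDefectLawAtTwo) : TorsionFreeIZeroStarDichotomyAtTwo := by
  intro W _ _ _ D hL hopt h4 hA
  constructor
  · intro hfull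
    by_contra hnot
    have hdef : padicValNat 2 (lineIndex (conwayStableLattice (W.conductorNorm ℤ)) D.f) + 1 =
        padicValNat 2 D.modularDegree := by
      by_cases he : W.semistabilityDefectAt 2 = 24
      · exact h48 W D hL hopt h4 hA he
      · have hloose : 0 < W.mordellWeilRank ∨
            padicValNat 2 W.torsionOrder < padicValNat 2 W.tamagawaProduct := by
          by_contra hno
          push Not at hno
          exact hnot ⟨⟨Nat.le_zero.mp hno.1, hno.2⟩, he⟩
        exact hglob W D hL hopt h4 hA hloose
    omega
  · rintro ⟨htight, he⟩
    exact h49 W D hL hopt h4 hA he htight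

end Laws

/-! ### The defect twin of `ConwayDepthTransfer` and its unconditional E-facing consequence -/

section DefectTransfer

/-- **Support statement `ConwayDefectTransfer`** (finite-index lattice bookkeeping, THEOREM-CANDIDATE — the defect twin of
the landed `ConwayCut.ConwayDepthTransfer`): if `4 ∣ N`, the Néron lattice lies in the Conway lattice (`Λ ≤ S^G`: Néron
mapping property for `t ∈ Aut_ℚ J₀(N)` + integrality at `∞`; NO equality `Λ ⊗ ℤ₍₂₎ = S^G ⊗ ℤ₍₂₎` is needed) and `S^G`
has a 2-adic DEFECT on the `f`-line, then the Néron datum has NO congruence depth at `2`.  Hypotheses aligned with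
the LANDED full-depth twin `…Theorems.ManinLocalTwoThree.conwayDepthTransfer_of_mem` (p625467): `D.f ∈ S^G` explicit
(at `4 ∣ N` it is `t f = −f` from `a₂ = 0` plus `w_Q f = ±f`), but only `Λ ≤ S^G` — NOT the odd-multiple half of
`IsConwayNeronAtTwo`.  Paper proof (same toolkit as p625467): with `M = S^G`, `θ = ⟨f,·⟩`, `c₀ = ⟨f,f⟩ ≠ 0`,
`K = ℤf + (M ∩ f^⊥)`, `r = #(M/K) ≠ 0`: `r` kills `M/K` and `θ(K) ⊆ ℤ c₀`, so every `g ∈ Λ ≤ M` has `θ(g) = (n/r)·c₀`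
with `n ∈ ℤ`; a depth witness `q c₀ = θ(g)` then has `q = n/r`, `ord₂ q ≥ −ord₂ r > −ord₂ deg φ`, contradiction. -/
@[conjecture]
def ConwayDefectTransfer : Prop :=
  ∀ (N : ℕ) [NeZero N] (W : WeierstrassCurve ℚ) [W.IsElliptic] (D : ModularParametrizationData W N)
    (Δ : NeronFLineDatum W D), 4 ∣ N → D.f ∈ conwayStableLattice N → Δ.Λ ≤ conwayStableLattice N →
    padicValNat 2 (lineIndex (conwayStableLattice N) D.f) < padicValNat 2 D.modularDegree →
    lineIndex (conwayStableLattice N) D.f ≠ 0 → ¬ Δ.NeronCongruenceDepthAt 2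

/-- PROVED E-facing consequence (no GIVEN row): under `ConwayDefectTransfer`, a Conway defect on an `f`-line forces
`2 ∣ c_E` OR failure of Lie-saturation of `E → J₀(N)` at `2` (the Néron map `𝓔 → 𝒥₀(N)` over `ℤ₂` kills the tangent
line mod `2`), by the landed collapse `NeronFLineDatum.depthAt_iff`.  Every `σ₂ = 1` row of the census is thus — modulo
the E-blind engine computation and this bookkeeping row — a certificate of «`2 ∣ c_E ∨ ¬ L1₂`»; with Cremona's `c_E = 1`
it locates the curves whose optimal parametrisation is not an immersion of Néron models at `p = 2 = e + 1`, the boundary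
case excluded from Raynaud's criterion `e < p − 1` (BLR 7.5/4; Agashe–Ribet–Stein 2012 §4.4). -/
theorem two_dvd_manin_or_not_lieSaturated_of_conwayDefect (hT : ConwayDefectTransfer) {N : ℕ} [NeZero N]
    {W : WeierstrassCurve ℚ} [W.IsElliptic] {D : ModularParametrizationData W N} (Δ : NeronFLineDatum W D)
    (h4 : 4 ∣ N) (hfM : D.f ∈ conwayStableLattice N) (hΛ : Δ.Λ ≤ conwayStableLattice N)
    (hdef : padicValNat 2 (lineIndex (conwayStableLattice N) D.f) < padicValNat 2 D.modularDegree)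
    (hfin : lineIndex (conwayStableLattice N) D.f ≠ 0) :
    (2 : ℤ) ∣ D.maninConstant ∨ ¬ Δ.LieSaturatedAt 2 := by
  haveI : Fact (Nat.Prime 2) := ⟨Nat.prime_two⟩
  have hnd : ¬ Δ.NeronCongruenceDepthAt 2 := hT N W D Δ h4 hfM hΛ hdef hfin
  by_contra h
  push Not at h
  exact hnd (Δ.depthAt_iff.mpr ⟨h.1, h.2⟩)

/-- The CHAIN on the primitive class (E-desc-48 + `ConwayDefectTransfer` + odd Manin constant ⇒ no Lie-saturation at 2):
for an optimal class-A curve with `e₂ = 24` and `2 ∤ c_E`, the optimal map `E → J₀(N)` is not Lie-saturated at `2`. -/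
theorem not_lieSaturatedAt_two_of_primitive (h48 : PrimitiveIZeroStarDefectLawAtTwo) (hT : ConwayDefectTransfer)
    (W : WeierstrassCurve ℚ) [W.IsElliptic] [W.IsGloballyMinimal] [NeZero (W.conductorNorm ℤ)]
    (D : ModularParametrizationData W (W.conductorNorm ℤ)) (Δ : NeronFLineDatum W D)
    (hL : ∀ z ∈ D.L.lattice, ∃ w ∈ periodLattice D.f, z = D.c * w)
    (hopt : ∀ (W' : WeierstrassCurve ℚ) [W'.IsElliptic]
        (D' : ModularParametrizationData W' (W.conductorNorm ℤ)),
        D'.f = D.f → D.modularDegree ≤ D'.modularDegree)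
    (h4 : 4 ∣ W.conductorNorm ℤ) (hA : IsTorsionFreeIZeroStarAtTwo W) (he : W.semistabilityDefectAt 2 = 24)
    (hfM : D.f ∈ conwayStableLattice (W.conductorNorm ℤ)) (hΛ : Δ.Λ ≤ conwayStableLattice (W.conductorNorm ℤ))
    (hfin : lineIndex (conwayStableLattice (W.conductorNorm ℤ)) D.f ≠ 0)
    (hc : ¬ (2 : ℤ) ∣ D.maninConstant) : ¬ Δ.LieSaturatedAt 2 := by
  have hdef := h48 W D hL hopt h4 hA he
  rcases two_dvd_manin_or_not_lieSaturated_of_conwayDefect hT Δ h4 hfM hΛ (by omega) hfin with h | h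
  · exact absurd h hc
  · exact h

end DefectTransfer

end Summit.BirchSwinnertonDyer.Rank1Residual.ManinAdditive.ConwayCut

end
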